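import Summits.BirchSwinnertonDyer.Rank1Residual.Additive.TypeGIntegralJ
import Summits.BirchSwinnertonDyer.Rank1Residual.Additive.SharpenedStatements
import Literature.NumberTheory.EllipticCurves.HasseWeilAbelianPotentialGoodReductionProofs
import Mathlib.NumberTheory.NumberField.Cyclotomic.Ideal
import HarnessLib

/-!
# Additive classes X3/X4: the data dictionary `e ∣ p − 1 ⇒ (G)` — good reduction over `ℚ(ζ_p)`

HONEST FRAMING (cell `b2b-bsdres`, run/shared/lean/b2b/bsd-rank1-residual/, verbatim in every
file): the goal of the cell is to DELETE the COMBINATION-SHAPED residual classes of the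
Birch–Swinnerton-Dyer formula for ALL analytic-rank `≤ 1` elliptic curves over `ℚ` — "full BSD
formula for every rank `≤ 1` curve in class `C`" assembled STRICTLY from published theorems — so
that the rank-`≤ 1` remainder becomes exactly the CONSTRUCTION-SHAPED classes, which are TYPED
(missing-input `Prop`s), NOT attempted. This is not "finishing BSD". Sub-cell `additive-p2`
(X3/X4 at an additive prime, potentially good ORDINARY half): research route; no claim beyond the
stated classes; theorems only, no named fact.

This file completes the kernel DICTIONARY "census data ⇒ Delbourgo's hypothesis (G)" for the
semistability defects `e ∈ {3, 4, 6}` (Kodaira `IV/IV*`, `III/III*`, `II/II*`; 599 of the 946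
X4♯(G-ord) census pairs and 33 of the 334 X3♯(G-ord) pairs, N < 2·10⁴), the defect-2 case being
`QuadraticTwistTypeG[Ord].lean` (gen 0). Data: `SubGord W p` of `SharpenedStatements.lean`
(additive-p4) = `¬(ord_p j < 0) ∧ f_p = 2 ∧ e ∣ p − 1`, `e = 12 / gcd(12, ord_p Δ_min)`. Theory:
`TypeG W p` (Delbourgo, Compositio 113 (1998) §1.5: good reduction over a subfield of `ℚ(ζ_p)`).

* `hasGoodReductionAt_of_valuation_j_le_one_of_valuation_pow_twelve` — over any number field, at a
  place `w ∤ 6`: `ord_w j ≥ 0` and `ord_w Δ ∈ 12·ℤ` (a `δ` with `w(δ)¹² = w(Δ)`) give good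
  reduction (Silverman *AEC* VII.5.1(a), Remark VII.1.1; valuation form of the tree's
  `hasGoodReductionAt_baseChange_of_pow_twelve_eq_Δ`).
* `typeG_of_padicValRat_j_nonneg_of_twelve_dvd` — **`p ≥ 5`, `ord_p j ≥ 0`, `12 ∣ (p−1)·ord_p Δ`
  ⟹ `TypeG W p`**, with witness `F = ⊤ = ℚ(ζ_p)` itself: `ℚ(ζ_p)/ℚ` is totally ramified at `p`,
  `e(w|p) = p − 1` (Mathlib `IsCyclotomicExtension.Rat.ramificationIdx_eq_of_prime_pow`), so
  `ord_w Δ = (p−1)·ord_p Δ ≡ 0 (mod 12)` (`valuation_liesOver`). This is Serre–Tate / Delbourgo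
  §1.2 Lemma (iv) ("`p ≡ 1 (d)`") in the form "tame potential good reduction of index `e` is
  realised over every tamely ramified extension of ramification index divisible by `e`".
* `twelve_dvd_of_semistabilityIndex_dvd`, `typeG_of_subGord` — **the census cell (G-ord) implies
  (G)**: `SubGord W p → 5 ≤ p → TypeG W p` (`e ∣ p − 1 ⇒ 12 = e·gcd(12, v) ∣ (p−1)·v`).

NOT transported here: the ORDINARY refinement (`TypeGOrd`) for `e ∈ {3,4,6}` — the reduction over
`ℚ(ζ_p)` has `j̃ = 0` (`e ∈ {3,6}`) or `1728` (`e = 4`) and is ordinary iff `p ≡ 1 (mod 3)` resp.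
`(mod 4)`, which `e ∣ p − 1` guarantees, but the point count of `y² = x³ + b` / `y² = x³ + ax` over
`𝔽_p` (Ireland–Rosen Ch. 18) is not in the tree in the needed form; for `e = 2` the ordinary
transport is `typeGOrd_of_goodOrd_quadraticTwist` (gen 0). At `p = 3` every (G-ord) pair has
`e = 2` (census 421/421) and is covered by the twist theorem.

References: D. Delbourgo, Compositio Math. 113 (1998) §1.2 Lemma, §1.5 (G); J.-P. Serre, J. Tate,
Ann. of Math. 88 (1968) §2 Cor. 2; J. H. Silverman, *AEC* VII.5.1, VII.1.1, *ATAEC* IV.9 Table 4.1;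
A. Kraus, Manuscripta Math. 69 (1990); L. Washington, *Cyclotomic Fields* Lemma 1.4 / Prop. 2.3
(total ramification of `p` in `ℚ(ζ_p)`).
-/

noncomputable section

open scoped Classical NumberField

open WeierstrassCurve IsDedekindDomain IsDedekindDomain.HeightOneSpectrum NumberField
  Literature.NumberTheory.EllipticCurves Literature.NumberTheory.EllipticCurves.Rank1Residual

namespace Summit.BirchSwinnertonDyer.Rank1Residual.Additive

/-! ### Good reduction from `ord_w(j) ≥ 0` and `12 ∣ ord_w(Δ)` at `w ∤ 6` -/

/-- **Good reduction at a place `w ∤ 6` with integral `j` and `12 ∣ ord_w(Δ)`** (Silverman *AEC*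
VII.5.1(a) with Remark VII.1.1: for residue characteristic `≥ 5`, a curve with `ord_w(j) ≥ 0` whose
discriminant valuation is a multiple of `12` has a `w`-integral model with unit discriminant).
Valuation form of the tree's `hasGoodReductionAt_baseChange_of_pow_twelve_eq_Δ` (which asks for
`δ¹² = Δ` exactly): here only `w(δ)¹² = w(Δ)` for some `δ`. Proof: rescale by `δ`
(`Δ₁ = δ⁻¹²Δ` is a `w`-unit), `c₄₁³ = j Δ₁` and `c₆₁² = c₄₁³ − 1728 Δ₁` are `w`-integral, and the
short Weierstrass form is `w`-integral with unit discriminant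
(`hasGoodReductionAt_of_valuation_le_one_of_valuation_Δ_eq_one`). -/
theorem hasGoodReductionAt_of_valuation_j_le_one_of_valuation_pow_twelve {L : Type*} [Field L]
    [NumberField L] (V : WeierstrassCurve L) [V.IsElliptic] {w : HeightOneSpectrum (𝓞 L)}
    (h2 : (2 : 𝓞 L) ∉ w.asIdeal) (h3 : (3 : 𝓞 L) ∉ w.asIdeal) (hj : w.valuation L V.j ≤ 1)
    {δ : L} (hδ : w.valuation L δ ^ 12 = w.valuation L V.Δ) : V.HasGoodReductionAt w := by
  -- `2`, `3` are `w`-units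
  have h2u : w.valuation L (2 : L) = 1 := by
    simpa using valuation_natCast_eq_one_of_natCast_notMem (K := L) (q := 2) (by simpa using h2)
  have h3u : w.valuation L (3 : L) = 1 := by
    simpa using valuation_natCast_eq_one_of_natCast_notMem (K := L) (q := 3) (by simpa using h3)
  have h48 : w.valuation L (48 : L) = 1 := by
    rw [show (48 : L) = 2 ^ 4 * 3 by norm_num, map_mul, map_pow, h2u, h3u]; simp
  have h864 : w.valuation L (864 : L) = 1 := by
    rw [show (864 : L) = 2 ^ 5 * 3 ^ 3 by norm_num, map_mul, map_pow, map_pow, h2u, h3u]; simp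
  have h1728 : w.valuation L (1728 : L) = 1 := by
    rw [show (1728 : L) = 2 ^ 6 * 3 ^ 3 by norm_num, map_mul, map_pow, map_pow, h2u, h3u]; simp
  -- `δ ≠ 0`
  have hΔ0 : V.Δ ≠ 0 := V.isUnit_Δ.ne_zero
  have hδ0 : δ ≠ 0 := by
    rintro rfl
    rw [map_zero, zero_pow (by norm_num)] at hδ
    exact (Valuation.ne_zero_iff _).mpr hΔ0 hδ.symm
  -- the rescaled model `W₁ = (δ, 0, 0, 0) • V`, `w(Δ₁) = 1`
  set C₁ : VariableChange L := ⟨Units.mk0 δ hδ0, 0, 0, 0⟩ with hC₁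
  set W₁ := C₁ • V with hW₁
  haveI hW₁ell : W₁.IsElliptic := inferInstanceAs (C₁ • V).IsElliptic
  have hC₁u : (↑C₁.u⁻¹ : L) = δ⁻¹ := by rw [Units.val_inv_eq_inv_val, hC₁, Units.val_mk0]
  have hΔ₁ : W₁.Δ = δ⁻¹ ^ 12 * V.Δ := by rw [hW₁, variableChange_Δ, hC₁u]
  have hvΔ₁ : w.valuation L W₁.Δ = 1 := by
    have hvδ : w.valuation L δ ≠ 0 := (Valuation.ne_zero_iff _).mpr hδ0
    rw [hΔ₁, map_mul, map_pow, map_inv₀, ← hδ, inv_pow, inv_mul_cancel₀ (pow_ne_zero _ hvδ)]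
  have hj₁ : W₁.j = V.j := V.variableChange_j C₁
  -- `c₄₁³ = j Δ₁`, `c₆₁² = c₄₁³ - 1728 Δ₁`
  have hc4cube : W₁.c₄ ^ 3 = W₁.j * W₁.Δ := by
    rw [WeierstrassCurve.j, ← coe_Δ', mul_comm (↑W₁.Δ'⁻¹ : L), mul_assoc, Units.inv_mul, mul_one]
  have hc4 : w.valuation L W₁.c₄ ≤ 1 := by
    rw [← pow_le_one_iff three_ne_zero, ← map_pow, hc4cube, map_mul, hvΔ₁, mul_one, hj₁]
    exact hj
  have hc6 : w.valuation L W₁.c₆ ≤ 1 := by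
    have hrel : W₁.c₆ ^ 2 = W₁.c₄ ^ 3 - 1728 * W₁.Δ := by rw [c_relation]; ring
    rw [← pow_le_one_iff two_ne_zero, ← map_pow, hrel]
    refine le_trans (Valuation.map_sub _ _ _) (max_le ?_ ?_)
    · rw [hc4cube, map_mul, hvΔ₁, mul_one, hj₁]; exact hj
    · rw [map_mul, h1728, hvΔ₁, mul_one]
  -- the short model `S = toShortNF • W₁`
  letI : Invertible (2 : L) := invertibleOfNonzero two_ne_zero
  letI : Invertible (3 : L) := invertibleOfNonzero three_ne_zero
  set S := W₁.toShortNF • W₁ with hS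
  haveI : S.IsShortNF := W₁.toShortNF_spec
  have hSu : W₁.toShortNF.u = 1 := by
    simp [toShortNF, toCharNeTwoNF, VariableChange.mul_def]
  have hSu' : (↑W₁.toShortNF.u⁻¹ : L) = 1 := by rw [hSu, inv_one, Units.val_one]
  have hSc4 : S.c₄ = W₁.c₄ := by rw [hS, variableChange_c₄, hSu', one_pow, one_mul]
  have hSc6 : S.c₆ = W₁.c₆ := by rw [hS, variableChange_c₆, hSu', one_pow, one_mul]
  have hSΔ : S.Δ = W₁.Δ := by rw [hS, variableChange_Δ, hSu', one_pow, one_mul]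
  have ha4 : w.valuation L S.a₄ ≤ 1 := by
    have h : w.valuation L S.a₄ = w.valuation L S.c₄ := by
      rw [S.c₄_of_isShortNF, map_mul, Valuation.map_neg, h48, one_mul]
    rw [h, hSc4]; exact hc4
  have ha6 : w.valuation L S.a₆ ≤ 1 := by
    have h : w.valuation L S.a₆ = w.valuation L S.c₆ := by
      rw [S.c₆_of_isShortNF, map_mul, Valuation.map_neg, h864, one_mul]
    rw [h, hSc6]; exact hc6
  have hgoodS : S.HasGoodReductionAt w :=
    S.hasGoodReductionAt_of_valuation_le_one_of_valuation_Δ_eq_one w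
      (by rw [S.a₁_of_isShortNF, map_zero]; exact zero_le)
      (by rw [S.a₂_of_isShortNF, map_zero]; exact zero_le)
      (by rw [S.a₃_of_isShortNF, map_zero]; exact zero_le) ha4 ha6
      (by rw [hSΔ, hvΔ₁])
  -- transport back along the two changes of variables
  have hgood₁ : W₁.HasGoodReductionAt w := (hasGoodReductionAt_smul_iff_holds w W₁ _).mp hgoodS
  exact (hasGoodReductionAt_smul_iff_holds w V C₁).mp hgood₁

/-! ### Good reduction over `ℚ(ζ_p)` when `12 ∣ (p − 1)·ord_p(Δ)` -/

/-- **Delbourgo's (G) from the data: `E` acquires good reduction over the `p`-th cyclotomic field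
when `ord_p j ≥ 0` and `12 ∣ (p − 1)·ord_p Δ`** (`p ≥ 5`). Let `L = ℚ(ζ_p)` and `w` the place above
`p`: `L/ℚ` is totally ramified at `p` with `e(w|p) = p − 1` (Mathlib
`IsCyclotomicExtension.Rat.ramificationIdx_eq_of_prime_pow`), so `ord_w Δ = (p − 1)·ord_p Δ ≡ 0
(mod 12)` and `ord_w j = (p − 1)·ord_p j ≥ 0` (`valuation_liesOver`); a uniformizer power `δ` has
`w(δ)¹² = w(Δ)`, and `hasGoodReductionAt_of_valuation_j_le_one_of_valuation_pow_twelve` gives good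
reduction of `E_L` at `w`. The witness of `TypeG W p` is `F = ⊤ ≤ ℚ(ζ_p)` — Delbourgo's (G) with
`d = p − 1` (Compositio 113 (1998) §1.5: "good reduction over a field `L ⊂ ℚ_p(μ_p)`"). For the
Kodaira types `IV, IV*` (e = 3), `III, III*` (e = 4), `II, II*` (e = 6), `I₀*` (e = 2) at `p ≥ 5`
the hypothesis is `e ∣ p − 1` (Serre–Tate; Delbourgo §1.2 Lemma (iv) "`p ≡ 1 (d)`"). -/
theorem typeG_of_padicValRat_j_nonneg_of_twelve_dvd (W : WeierstrassCurve ℚ) [W.IsElliptic]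
    (p : ℕ) [hp : Fact p.Prime] (hp5 : 5 ≤ p) (hj : 0 ≤ padicValRat p W.j)
    (hdvd : (12 : ℤ) ∣ ((p : ℤ) - 1) * padicValRat p W.Δ) : TypeG W p := by
  haveI hcyc : IsCyclotomicExtension {p} ℚ (CyclotomicField p ℚ) := by
    have h : (CyclotomicField.algebra p ℚ : Algebra ℚ (CyclotomicField p ℚ)) =
        DivisionRing.toRatAlgebra :=
      Subsingleton.elim _ _
    exact h ▸ CyclotomicField.isCyclotomicExtension p ℚ
  set F : IntermediateField ℚ (CyclotomicField p ℚ) := ⊤ with hFdef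
  refine ⟨CyclotomicField p ℚ, inferInstance, inferInstance, hcyc, F, fun w hw ↦ ?_⟩
  haveI : NumberField F := NumberField.of_module_finite ℚ _
  -- `F = ⊤ ≃ ℚ(ζ_p)` is a `p`-th cyclotomic extension of `ℚ` (for the `ℚ`-algebra structure of a
  -- number field, `DivisionRing.toRatAlgebra`; all `ℚ`-algebra structures coincide)
  haveI hcycF : IsCyclotomicExtension {p ^ (0 + 1)} ℚ F := by
    rw [zero_add, pow_one]
    have key := IsCyclotomicExtension.equiv {p} ℚ (CyclotomicField p ℚ)
      (IntermediateField.topEquiv (F := ℚ) (E := CyclotomicField p ℚ)).symm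
    convert key
    exact Subsingleton.elim _ _
  -- the place of `ℤ` below `w` is `(p)`
  set v : HeightOneSpectrum ℤ := (Rat.HeightOneSpectrum.primesEquiv (R := ℤ)).symm ⟨p, hp.out⟩
    with hvdef
  have hv : Rat.HeightOneSpectrum.natGenerator v = p :=
    congrArg Subtype.val ((Rat.HeightOneSpectrum.primesEquiv (R := ℤ)).apply_symm_apply ⟨p, hp.out⟩)
  have hvspan : v.asIdeal = Ideal.span {(p : ℤ)} := by
    rw [Rat.HeightOneSpectrum.asIdeal_eq_span_natGenerator_int, hv]
  have hunder : w.asIdeal.under ℤ = v.asIdeal := by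
    have hle : v.asIdeal ≤ w.asIdeal.under ℤ := by
      rw [hvspan, Ideal.span_le, Set.singleton_subset_iff, SetLike.mem_coe, Ideal.under_def,
        Ideal.mem_comap, map_natCast]
      exact hw
    exact (v.isMaximal.eq_of_le (Ideal.IsPrime.ne_top inferInstance) hle).symm
  haveI hlies : w.asIdeal.LiesOver v.asIdeal := ⟨hunder.symm⟩
  haveI hlies' : w.asIdeal.LiesOver (Ideal.span {(p : ℤ)}) := by rw [← hvspan]; exact hlies
  -- `e(w|p) = p − 1`
  have hpbot : Ideal.span {(p : ℤ)} ≠ ⊥ := by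
    rw [Ne, Ideal.span_singleton_eq_bot]; exact_mod_cast hp.out.ne_zero
  have he : v.asIdeal.ramificationIdx' w.asIdeal = p - 1 := by
    rw [hvspan, Ideal.ramificationIdx'_eq_ramificationIdx _ _ hpbot,
      IsCyclotomicExtension.Rat.ramificationIdx_eq_of_prime_pow p 0 F w.asIdeal, pow_zero, one_mul]
  -- `2, 3 ∉ w`
  have hnotMem : ∀ q : ℕ, q < p → q ≠ 0 → (q : 𝓞 F) ∉ w.asIdeal := by
    intro q hq hq0 hmem
    have h1 : (q : ℤ) ∈ w.asIdeal.under ℤ := by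
      rw [Ideal.under_def, Ideal.mem_comap, map_natCast]; exact hmem
    rw [hunder, hvspan, Ideal.mem_span_singleton] at h1
    have h2 : p ∣ q := by exact_mod_cast h1
    exact absurd (Nat.le_of_dvd (Nat.pos_of_ne_zero hq0) h2) (not_le.mpr hq)
  have h2 : (2 : 𝓞 F) ∉ w.asIdeal := by simpa using hnotMem 2 (by omega) two_ne_zero
  have h3 : (3 : 𝓞 F) ∉ w.asIdeal := by simpa using hnotMem 3 (by omega) three_ne_zero
  -- the curve upstairs
  haveI : (W.baseChange F).IsElliptic := by rw [baseChange]; infer_instance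
  have hjF : (W.baseChange F).j = algebraMap ℚ F W.j := W.map_j (algebraMap ℚ F)
  have hΔF : (W.baseChange F).Δ = algebraMap ℚ F W.Δ := by rw [baseChange, map_Δ]
  -- `w(j) ≤ 1`
  have hjw : w.valuation F (W.baseChange F).j ≤ 1 := by
    rw [hjF, ← valuation_liesOver (K := ℚ) (L := F) v w W.j]
    apply pow_le_one₀ zero_le
    by_cases hj0 : W.j = 0
    · rw [hj0, map_zero]; exact zero_le
    rw [Rat.HeightOneSpectrum.valuation_eq_exp_neg_padicValRat v hj0, hv, ← WithZero.exp_zero,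
      WithZero.exp_le_exp]
    linarith
  -- `w(Δ) = exp(−(p−1)·ord_p Δ) = w(δ)¹²` for a uniformizer power `δ`
  have hΔ0 : W.Δ ≠ 0 := W.isUnit_Δ.ne_zero
  obtain ⟨k, hk⟩ := hdvd
  obtain ⟨π, hπ⟩ := w.valuation_exists_uniformizer F
  have hπ0 : π ≠ 0 := by
    intro h0; rw [h0, map_zero] at hπ; exact WithZero.exp_ne_zero hπ.symm
  have hvΔ : w.valuation F (W.baseChange F).Δ = WithZero.exp (-(12 * k)) := by
    rw [hΔF, ← valuation_liesOver (K := ℚ) (L := F) v w W.Δ, he,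
      Rat.HeightOneSpectrum.valuation_eq_exp_neg_padicValRat v hΔ0, hv, ← WithZero.exp_nsmul, ← hk]
    congr 1
    have h1 : ((p - 1 : ℕ) : ℤ) = (p : ℤ) - 1 := by
      have := hp.out.one_lt.le
      omega
    rw [nsmul_eq_mul, h1]
    ring
  have hδ : w.valuation F (π ^ k) ^ 12 = w.valuation F (W.baseChange F).Δ := by
    rw [hvΔ, map_zpow₀, hπ, ← WithZero.exp_zsmul, ← WithZero.exp_nsmul]
    congr 1
    simp only [smul_eq_mul, nsmul_eq_mul]
    push_cast
    ring
  exact hasGoodReductionAt_of_valuation_j_le_one_of_valuation_pow_twelve (W.baseChange F) h2 h3 hjw hδ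

/-! ### The census cell (G-ord) implies (G) -/

/-- `e ∣ p − 1 ⟹ 12 ∣ (p − 1)·ord_p Δ_min`, where `e = 12 / gcd(12, ord_p Δ_min)` is the census's
semistability index (`semistabilityIndex`): `12 = e · gcd(12, v)` and `gcd(12, v) ∣ v`. -/
theorem twelve_dvd_of_semistabilityIndex_dvd (W : WeierstrassCurve ℚ) [W.IsElliptic]
    [W.IsGloballyMinimal] (p : ℕ) [Fact p.Prime] (h : semistabilityIndex W p ∣ p - 1) :
    12 ∣ (p - 1) * padicValInt p W.minimalDiscriminantInt := by
  set v := padicValInt p W.minimalDiscriminantInt with hv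
  have hg12 : Nat.gcd 12 v ∣ 12 := Nat.gcd_dvd_left 12 v
  have hgv : Nat.gcd 12 v ∣ v := Nat.gcd_dvd_right 12 v
  have he : semistabilityIndex W p * Nat.gcd 12 v = 12 := by
    show 12 / Nat.gcd 12 v * Nat.gcd 12 v = 12
    exact Nat.div_mul_cancel hg12
  have h1 : 12 ∣ (p - 1) * Nat.gcd 12 v := by
    have h2 := Nat.mul_dvd_mul_right h (Nat.gcd 12 v)
    rwa [he] at h2
  exact dvd_trans h1 (Nat.mul_dvd_mul_left _ hgv)

/-- **The census cell (G-ord) is of Delbourgo type (G)** (`p ≥ 5`): `SubGord W p` — not potentially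
multiplicative, `f_p = 2`, `e ∣ p − 1` (SHARPENED-CONJECTURES §3, additive-p4's
`SharpenedStatements.lean`) — implies `TypeG W p`, good reduction over `ℚ(ζ_p)`
(`typeG_of_padicValRat_j_nonneg_of_twelve_dvd`; only `¬(ord_p j < 0)` and `e ∣ p − 1` are used,
the conductor bit `f_p = 2` being automatic at `p ≥ 5`). Together with gen 0's e = 2 theorems this
is the kernel form of the dictionary "X3♯(G-ord)/X4♯(G-ord) census cell ⊆ Delbourgo (G)" for all
`p ≥ 5`; the ordinary refinement for `e ∈ {3,4,6}` stays data-level (module docstring). -/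
theorem typeG_of_subGord (W : WeierstrassCurve ℚ) [W.IsElliptic] [W.IsGloballyMinimal] (p : ℕ)
    [hp : Fact p.Prime] (hp5 : 5 ≤ p) (hS : SubGord W p) : TypeG W p := by
  obtain ⟨hnot, -, he⟩ := hS
  have hj : 0 ≤ padicValRat p W.j := not_lt.mp hnot
  have h12 := twelve_dvd_of_semistabilityIndex_dvd W p he
  refine typeG_of_padicValRat_j_nonneg_of_twelve_dvd W p hp5 hj ?_
  rw [← cast_minimalDiscriminantInt W, padicValRat.of_int]
  have h1 : ((p - 1 : ℕ) : ℤ) = (p : ℤ) - 1 := by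
    have := hp.out.one_lt.le
    omega
  rw [← h1]
  exact_mod_cast h12

/-- **X3 ∩ (G-ord census cell) ⊆ X3 ∩ (G)** and **X4 ∩ (G-ord census cell) ⊆ X4 ∩ (G)** at
`p ≥ 5`: the additive classes restricted to additive-p4's data cell `SubGord` are of Delbourgo type
(G). (The targets `X3Gord.Statement`/`X4Gord.Statement` of `PotGoodOrdinary.lean` use the ORDINARY
form `TypeGOrd`; for `e = 2` see `classX3Gord_of_goodOrd_quadraticTwist`.) -/
theorem typeG_of_classX3_or_classX4_of_subGord (W : WeierstrassCurve ℚ) [W.IsElliptic]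
    [W.IsGloballyMinimal] (p : ℕ) [Fact p.Prime] (hp5 : 5 ≤ p) (_hX : ClassX3 W p ∨ ClassX4 W p)
    (hS : SubGord W p) : TypeG W p :=
  typeG_of_subGord W p hp5 hS

end Summit.BirchSwinnertonDyer.Rank1Residual.Additive

end
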